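import Mathlib
import Summits.Ventures.HodgeRepro2.T5AdicCompletionSelfDuality
import Summits.Ventures.HodgeRepro2.T5ContinuousDescent

/-!
# A continuous non-trivial character of a `Valued` field exists (when `[B 0 : B (−1)]` is finite)

Non-vacuity of the self-duality statements: on `Kv = v.adicCompletion K` some continuous
`ψ : AddChar Kv Circle` with `ψ ≠ 1` exists.  Construction: the unit ball `B 0 = O_Kv` is an open
subgroup with the open subgroup `B (−1) = 𝔪` of finite index `≥ 2` (`1 ∈ B 0 ∖ B (−1)`); the finite
quotient has a non-trivial `Circle`-character (`T5CircleCharacterCount`), which is a continuous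
character of `B 0` trivial on the open `B (−1)`, and `T5ContinuousDescent` extends it continuously
to the whole group.

Declaration per README §8(d): «uses an L-value-free non-vanishing device: NO».
-/

namespace Summit.Ventures.HodgeRepro2.T5ExistsCharacter

open WithZero T5ValuedBallBasis T5BallCharacters

variable {K : Type*} [Field K] [Valued K ℤᵐ⁰]

/-- The unit ball `B 0` as a subgroup of `Multiplicative K`. -/
abbrev unitBall : Subgroup (Multiplicative K) := AddSubgroup.toSubgroup (ball (K := K) 0)

/-- The ball `B (−1)` as a subgroup of `unitBall`. -/
abbrev maxBall : Subgroup (unitBall (K := K)) :=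
  (AddSubgroup.toSubgroup (ball (K := K) (-1))).subgroupOf unitBall

/-- `B 0` is open. -/
theorem isOpen_unitBall : IsOpen ((unitBall (K := K) : Subgroup (Multiplicative K)) : Set (Multiplicative K)) :=
  isOpen_ball (R := K) 0

/-- `B (−1)` is open in `B 0`. -/
theorem isOpen_maxBall : IsOpen ((maxBall (K := K) : Subgroup (unitBall (K := K))) : Set (unitBall (K := K))) := by
  have : ((maxBall (K := K) : Subgroup (unitBall (K := K))) : Set (unitBall (K := K))) =
      (fun x : unitBall (K := K) => (Multiplicative.toAdd (x : Multiplicative K) : K)) ⁻¹'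
        {y : K | Valued.v y ≤ exp (-1)} := by
    ext x
    rfl
  rw [this]
  exact (isOpen_ball (R := K) (-1)).preimage continuous_subtype_val

/-- The class of `1` shows `B (−1) ≠ B 0`. -/
theorem maxBall_ne_top : (maxBall (K := K)) ≠ ⊤ := by
  intro h
  have hmem : Multiplicative.ofAdd (1 : K) ∈ unitBall (K := K) := by
    show (1 : K) ∈ ball (K := K) 0
    rw [mem_ball_iff, map_one, exp_zero]
  have h1 : (⟨Multiplicative.ofAdd (1 : K), hmem⟩ : unitBall (K := K)) ∈ maxBall := by
    rw [h]; exact Subgroup.mem_top _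
  have h1' : (1 : K) ∈ ball (K := K) (-1) := h1
  rw [mem_ball_iff, map_one] at h1'
  have := (lt_exp_succ_iff_le_exp (1 : ℤᵐ⁰) (-1)).2 h1'
  rw [show (-1 : ℤ) + 1 = 0 by norm_num, exp_zero] at this
  exact lt_irrefl _ this

/-- A character of `B 0` trivial on `B (−1)` that is NOT trivial (the quotient is finite of order
`≥ 2`, so it has `≥ 2` characters). -/
theorem exists_ne_one_eq_one_on_maxBall (hfin : (maxBall (K := K)).index ≠ 0) :
    ∃ χ : unitBall (K := K) →* Circle, (∀ x ∈ maxBall (K := K), χ x = 1) ∧ χ ≠ 1 := by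
  have hcard := T5CircleCharacterCount.card_ker_restrictHom_circle (maxBall (K := K)) hfin
  have h2 : 2 ≤ (maxBall (K := K)).index := by
    have h1 : (maxBall (K := K)).index ≠ 1 := fun h => maxBall_ne_top (Subgroup.index_eq_one.1 h)
    omega
  by_contra hno
  -- every element of the kernel is `1`, so the kernel has one element
  have hsub : ∀ χ ∈ (MonoidHom.restrictHom (maxBall (K := K)) Circle).ker, χ = 1 := fun χ hχ =>
    by_contra fun hne => hno ⟨χ, (T5CircleCharacterCount.mem_ker_restrictHom_iff _ χ).1 hχ, hne⟩
  have hone : Nat.card (MonoidHom.restrictHom (maxBall (K := K)) Circle).ker = 1 := by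
    rw [Nat.card_eq_one_iff_unique]
    refine ⟨⟨fun a b => Subtype.ext ?_⟩, ⟨⟨1, one_mem _⟩⟩⟩
    rw [hsub a a.2, hsub b b.2]
  omega

/-- A character of `B 0` trivial on the open `B (−1)` is continuous. -/
theorem continuous_of_eq_one_on_maxBall (χ : unitBall (K := K) →* Circle)
    (h : ∀ x ∈ maxBall (K := K), χ x = 1) : Continuous χ :=
  T5ContinuousCharacterExtension.continuous_of_continuousOn_open_subgroup (maxBall (K := K))
    isOpen_maxBall χ (continuousOn_const.congr fun x hx => h x hx)

/-- EXISTENCE of a continuous non-trivial character (given `[B 0 : B (−1)] ≠ 0`). -/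
theorem exists_continuous_ne_one (hfin : (maxBall (K := K)).index ≠ 0) :
    ∃ ψ : AddChar K Circle, Continuous ψ ∧ ψ ≠ 1 := by
  obtain ⟨χ, hχN, hχ⟩ := exists_ne_one_eq_one_on_maxBall hfin
  obtain ⟨ψ', hψc, hext, -⟩ :=
    T5ContinuousDescent.exists_continuous_extension_circle_of_eq_one_on_inf (unitBall (K := K)) ⊥
      isOpen_unitBall χ (continuous_of_eq_one_on_maxBall χ hχN) (fun x hx => by
        rw [Subgroup.mem_bot] at hx
        have : x = 1 := Subtype.ext hx
        rw [this, map_one])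
  refine ⟨AddChar.toMonoidHomEquiv.symm ψ', ?_, ?_⟩
  · have : ((AddChar.toMonoidHomEquiv.symm ψ' : AddChar K Circle) : K → Circle) =
        fun a => ψ' (Multiplicative.ofAdd a) := by
      funext a
      exact AddChar.toMonoidHomEquiv_symm_apply ψ' a
    rw [this]
    exact hψc
  · intro h
    apply hχ
    refine MonoidHom.ext fun x => ?_
    rw [← hext x]
    have h' : ψ' (x : Multiplicative K) = 1 := by
      have := congrArg (fun φ : AddChar K Circle => φ (Multiplicative.toAdd (x : Multiplicative K))) h
      rw [AddChar.toMonoidHomEquiv_symm_apply, AddChar.one_apply, ofAdd_toAdd] at this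
      exact this
    rw [h', MonoidHom.one_apply]

/-- `[B 0 : B (−1)]` in the two bookkeepings agree. -/
theorem index_maxBall : (maxBall (K := K)).index = (ball (K := K) (-1)).relIndex (ball 0) := by
  show ((AddSubgroup.toSubgroup (ball (K := K) (-1))).comap (unitBall (K := K)).subtype).index = _
  rw [Subgroup.index_comap, Subgroup.range_subtype, AddSubgroup.relIndex_toSubgroup]

section Completions

open IsDedekindDomain HeightOneSpectrum

variable {R : Type*} [CommRing R] [IsDedekindDomain R] {K : Type*} [Field K] [Algebra R K]
  [IsFractionRing R K] (v : HeightOneSpectrum R)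
  [Finite (IsLocalRing.ResidueField (adicCompletionIntegers K v))]

/-- A continuous non-trivial additive character of `v.adicCompletion K` EXISTS. -/
theorem exists_continuous_ne_one_adicCompletion :
    ∃ ψ : AddChar (adicCompletion K v) Circle, Continuous ψ ∧ ψ ≠ 1 :=
  exists_continuous_ne_one (by
    rw [index_maxBall]
    exact T5AdicCompletionSelfDuality.relIndex_ball_neg_one_zero_ne_zero v)

end Completions

end Summit.Ventures.HodgeRepro2.T5ExistsCharacter
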